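import Summits.SmoothPoincare4.SmoothPoincare4.Theorems.ConvexBisectionAcyclicBisectionExistsT3AssemblyClosedK
import HarnessLib

/-!
# Dual handles, node `Hgap`: the assembly from the twisting number of the UNIVERSAL straightening (margin form)
(sub-goal of stub `stub_T3_dualPresentation` (T3) ▸ node `Hgap` ▸ part C (assembly, hedge), line
`modp-braid-orbits`, crux `ConvexBisection.AcyclicBisectionExists`, item stmt-SmoothPoincare4-10508; wave 6,
lead c5, worker G3; registered sub-goal `helper_sign_bool_coupling`)

Sequel of `…HgapAssembly.lean` (`HgapK_of_HB (HB) : HgapK`) and `…T3AssemblyClosedK.lean`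
(`T3_of_HB (HB) : <stub_T3_dualPresentation>`).  There `HB` is G2's twisting number stated for an ARBITRARY
fibred ambient isotopy `R` flattening the dual circle (G2's `HBStatement` V1).  G2 lands its proof in bricks;
should its final theorem be stated only for the universal straightening `S = strIso g m hm` of ST2/X3 with
G1's MARGIN clause `2m ≤ ‖w‖` on the dual circles (the objects G1's `Hgap_transport` actually produces), the
weaker statement `HBm` below is what is needed, and this file provides the same two conclusions from it:

* §1 `HBm_of_HB`: the general form implies the margin form (instantiate `R := strIso g m hm`);
* §2 `HgapK_of_HBm (HBm) : HgapK` (the proof of `HgapK_of_HB`, keeping G1's margin clause `hmar`);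
* §3 `T3_of_HBm (HBm) : <sig_stub_T3.txt VERBATIM> := T3_of_two_pieces_K helper_seam_twistSign (HgapK_of_HBm HBm)`;
* §4 the registered rider `helper_sign_bool_coupling` (the Bool of the node: `s := decide (s₀ = 1)` gives
  twisting `-s₀` and character `s₀`).

Everything here is proved; `HBm` enters as hypothesis; no `sorry`.

## References
* R. İ. Baykur, *Kähler decomposition of 4-manifolds*, AGT 6 (2006), proof of Thm. 5.1. [Baykur2006]
* J. B. Etnyre, T. Fuller, *Realizing 4-manifolds as achiral Lefschetz fibrations*, IMRN (2006), Thm. 1. [EtnyreFuller2006]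
-/

noncomputable section

-- the prescribed namespace `Summit.<P>.<Sub>.…` duplicates `SmoothPoincare4` (P = Sub)
set_option linter.dupNamespace false

open scoped Manifold ContDiff Topology

namespace Summit.SmoothPoincare4.SmoothPoincare4.Theorems.AcyclicBisectionExists.ModpBraidOrbits

open Set Function Metric Filter
open Literature.Topology.FourManifolds Literature.Topology.FourManifolds.HandleAttachingMap
  Literature.Topology.FourManifolds.BoundaryManifold Literature.Topology.FourManifolds.LefschetzBase
  Literature.Geometry.Symplectic

/-! ## §1 The margin form of the twisting number follows from the general form -/

/-- **G2's twisting number for an arbitrary fibred flattening implies the margin form** (the universal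
straightening `strIso g m hm` is fibred: `str_rho_base`, `str_dir_base`). [cite: Baykur2006, Thm. 5.1 (proof, p. 13)] -/
theorem HBm_of_HB
    (HB : ∀ (g : ℕ) (l : List ((Fin g ⊕ Fin g → ℤ) × Bool)) (h : Fin l.length → HandleAttachingMap 3 2 (Base g)),
    IsLefschetzLink g l h →
    ∀ {X : Type} [TopologicalSpace X] [T2Space X] [SecondCountableTopology X] [CompactSpace X]
      [ChartedSpace (EuclideanHalfSpace 4) X] [IsManifold (𝓡∂ 4) ∞ X]
      (D : MultiAttachmentData h (𝓡∂ 4) X) (bX : BoundaryData (𝓡∂ 4) X (𝓡 3)) [Nonempty bX.carrier]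
      (Ψ : bX.carrier ≃ₘ⟮𝓡 3, 𝓡 3⟯ (bBase g).carrier),
      (∀ (y : bX.carrier) (a : ↥(coresComplement h)), bX.incl y = D.jA a →
        ∃ c : ℝ, 0 < c ∧ w g ((bBase g).incl (Ψ y)).1 = (c : ℂ) * w g (a : Base g).1) →
    ∀ (s₀ : ℤ), (s₀ = 1 ∨ s₀ = -1) →
      (∀ (y : (bBase g).carrier) (_ : (y.1 : Base g) ∈ coresComplement h) (c : ℂ) (_ : ‖c‖ = 1)
        (_ : y.1 ∈ page g c) (R : AmbientIsotopy (𝓡∂ 4) (Base g))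
        (_ : ∀ (t : ℝ) (x : Base g), rho g (R.toFun t x).1 = rho g x.1)
        (_ : ∀ (t : ℝ) (x : Base g), ∃ r : ℝ, 0 < r ∧ w g (R.toFun t x).1 = (r : ℂ) * w g x.1)
        (_ : R.toFun 1 (seamB D bX Ψ y) ∈ page g c),
        0 < (s₀ : ℝ) * pageDet g (bdDeriv g (R.toFun 1 ∘ seamB D bX Ψ) y) y.1.1) →
    ∀ (col : (BoundaryManifold.boundaryData 3 (Base g)).Collar) (κ δ : ℝ) (hκ : 0 < κ) (hκ1 : κ ≤ 1)
      (hδ : 0 < δ) (hδ2 : δ ≤ 1 / 2) (j : Fin l.length) (c : ℂ) (_ : ‖c‖ = 1)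
      (R : AmbientIsotopy (𝓡∂ 4) (Base g))
      (_ : ∀ (t : ℝ) (x : Base g), rho g (R.toFun t x).1 = rho g x.1)
      (_ : ∀ (t : ℝ) (x : Base g), ∃ r : ℝ, 0 < r ∧ w g (R.toFun t x).1 = (r : ℂ) * w g x.1)
      (_ : ∀ θ, R.toFun 1 ((dualMap D bX (bBase g) Ψ col κ δ hκ hκ1 hδ hδ2 j).attachingCircle θ) ∈ page g c),
      pageTwisting g
          ((dualMap D bX (bBase g) Ψ col κ δ hκ hκ1 hδ hδ2 j).transport (R.toDiffeomorph 1)).attachingCircle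
          ((dualMap D bX (bBase g) Ψ col κ δ hκ hκ1 hδ hδ2 j).transport (R.toDiffeomorph 1)).attachingFraming =
        -s₀ * (if (l.get j).2 then -1 else 1)) :
    ∀ (g : ℕ) (l : List ((Fin g ⊕ Fin g → ℤ) × Bool)) (h : Fin l.length → HandleAttachingMap 3 2 (Base g)),
    IsLefschetzLink g l h →
    ∀ {X : Type} [TopologicalSpace X] [T2Space X] [SecondCountableTopology X] [CompactSpace X]
      [ChartedSpace (EuclideanHalfSpace 4) X] [IsManifold (𝓡∂ 4) ∞ X]
      (D : MultiAttachmentData h (𝓡∂ 4) X) (bX : BoundaryData (𝓡∂ 4) X (𝓡 3)) [Nonempty bX.carrier]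
      (Ψ : bX.carrier ≃ₘ⟮𝓡 3, 𝓡 3⟯ (bBase g).carrier),
      (∀ (y : bX.carrier) (a : ↥(coresComplement h)), bX.incl y = D.jA a →
        ∃ c : ℝ, 0 < c ∧ w g ((bBase g).incl (Ψ y)).1 = (c : ℂ) * w g (a : Base g).1) →
    ∀ (s₀ : ℤ), (s₀ = 1 ∨ s₀ = -1) →
      (∀ (y : (bBase g).carrier) (_ : (y.1 : Base g) ∈ coresComplement h) (c : ℂ) (_ : ‖c‖ = 1)
        (_ : y.1 ∈ page g c) (R : AmbientIsotopy (𝓡∂ 4) (Base g))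
        (_ : ∀ (t : ℝ) (x : Base g), rho g (R.toFun t x).1 = rho g x.1)
        (_ : ∀ (t : ℝ) (x : Base g), ∃ r : ℝ, 0 < r ∧ w g (R.toFun t x).1 = (r : ℂ) * w g x.1)
        (_ : R.toFun 1 (seamB D bX Ψ y) ∈ page g c),
        0 < (s₀ : ℝ) * pageDet g (bdDeriv g (R.toFun 1 ∘ seamB D bX Ψ) y) y.1.1) →
    ∀ (col : (BoundaryManifold.boundaryData 3 (Base g)).Collar) (κ δ : ℝ) (hκ : 0 < κ) (hκ1 : κ ≤ 1)
      (hδ : 0 < δ) (hδ2 : δ ≤ 1 / 2) (j : Fin l.length) (c : ℂ) (_ : ‖c‖ = 1)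
      (m : ℝ) (hm : 0 < m)
      (_ : ∀ θ, 2 * m ≤ ‖w g ((dualMap D bX (bBase g) Ψ col κ δ hκ hκ1 hδ hδ2 j).attachingCircle θ).1‖)
      (_ : ∀ θ, (strIso g m hm).toFun 1 ((dualMap D bX (bBase g) Ψ col κ δ hκ hκ1 hδ hδ2 j).attachingCircle θ) ∈ page g c),
      pageTwisting g
          ((dualMap D bX (bBase g) Ψ col κ δ hκ hκ1 hδ hδ2 j).transport ((strIso g m hm).toDiffeomorph 1)).attachingCircle
          ((dualMap D bX (bBase g) Ψ col κ δ hκ hκ1 hδ hδ2 j).transport ((strIso g m hm).toDiffeomorph 1)).attachingFraming =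
        -s₀ * (if (l.get j).2 then -1 else 1) :=
  fun g l h hlink _ _ _ _ _ _ _ D bX _ Ψ hpage s₀ hs₀ Hs₀ col κ δ hκ hκ1 hδ hδ2 j c hc m hm _ hpg =>
    HB g l h hlink D bX Ψ hpage s₀ hs₀ Hs₀ col κ δ hκ hκ1 hδ hδ2 j c hc (strIso g m hm) (str_rho_base m hm)
      (str_dir_base m hm) hpg

/-! ## §2 The node with data from the margin form -/

set_option maxHeartbeats 800000 in
-- a telescope of ~60 binders with long dependent types (as in X2's `T3_of_pieces`)
/-- **The node `Hgap` WITH DATA from the MARGIN form `HBm` of G2's twisting number** (same proof as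
`HgapK_of_HB`, feeding G1's margin clause `2m ≤ ‖w‖` on the dual circles to `HBm`).
[cite: Baykur2006, Thm. 5.1 (proof, pp. 13–14)] -/
theorem HgapK_of_HBm
    (HBm : ∀ (g : ℕ) (l : List ((Fin g ⊕ Fin g → ℤ) × Bool)) (h : Fin l.length → HandleAttachingMap 3 2 (Base g)),
    IsLefschetzLink g l h →
    ∀ {X : Type} [TopologicalSpace X] [T2Space X] [SecondCountableTopology X] [CompactSpace X]
      [ChartedSpace (EuclideanHalfSpace 4) X] [IsManifold (𝓡∂ 4) ∞ X]
      (D : MultiAttachmentData h (𝓡∂ 4) X) (bX : BoundaryData (𝓡∂ 4) X (𝓡 3)) [Nonempty bX.carrier]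
      (Ψ : bX.carrier ≃ₘ⟮𝓡 3, 𝓡 3⟯ (bBase g).carrier),
      (∀ (y : bX.carrier) (a : ↥(coresComplement h)), bX.incl y = D.jA a →
        ∃ c : ℝ, 0 < c ∧ w g ((bBase g).incl (Ψ y)).1 = (c : ℂ) * w g (a : Base g).1) →
    ∀ (s₀ : ℤ), (s₀ = 1 ∨ s₀ = -1) →
      (∀ (y : (bBase g).carrier) (_ : (y.1 : Base g) ∈ coresComplement h) (c : ℂ) (_ : ‖c‖ = 1)
        (_ : y.1 ∈ page g c) (R : AmbientIsotopy (𝓡∂ 4) (Base g))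
        (_ : ∀ (t : ℝ) (x : Base g), rho g (R.toFun t x).1 = rho g x.1)
        (_ : ∀ (t : ℝ) (x : Base g), ∃ r : ℝ, 0 < r ∧ w g (R.toFun t x).1 = (r : ℂ) * w g x.1)
        (_ : R.toFun 1 (seamB D bX Ψ y) ∈ page g c),
        0 < (s₀ : ℝ) * pageDet g (bdDeriv g (R.toFun 1 ∘ seamB D bX Ψ) y) y.1.1) →
    ∀ (col : (BoundaryManifold.boundaryData 3 (Base g)).Collar) (κ δ : ℝ) (hκ : 0 < κ) (hκ1 : κ ≤ 1)
      (hδ : 0 < δ) (hδ2 : δ ≤ 1 / 2) (j : Fin l.length) (c : ℂ) (_ : ‖c‖ = 1)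
      (m : ℝ) (hm : 0 < m)
      (_ : ∀ θ, 2 * m ≤ ‖w g ((dualMap D bX (bBase g) Ψ col κ δ hκ hκ1 hδ hδ2 j).attachingCircle θ).1‖)
      (_ : ∀ θ, (strIso g m hm).toFun 1 ((dualMap D bX (bBase g) Ψ col κ δ hκ hκ1 hδ hδ2 j).attachingCircle θ) ∈ page g c),
      pageTwisting g
          ((dualMap D bX (bBase g) Ψ col κ δ hκ hκ1 hδ hδ2 j).transport ((strIso g m hm).toDiffeomorph 1)).attachingCircle
          ((dualMap D bX (bBase g) Ψ col κ δ hκ hκ1 hδ hδ2 j).transport ((strIso g m hm).toDiffeomorph 1)).attachingFraming =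
        -s₀ * (if (l.get j).2 then -1 else 1)) :
    ∀ (g : ℕ) (P N : List ((Fin g ⊕ Fin g → ℤ) × Bool)) (h : Fin (P ++ N).length → HandleAttachingMap 3 2 (Base g)) (hlink : IsLefschetzLink g (P ++ N) h), ∃ κ₁ : ℝ, 0 < κ₁ ∧ ∀ {X : Type} [TopologicalSpace X] [T2Space X] [SecondCountableTopology X] [CompactSpace X] [ChartedSpace (EuclideanHalfSpace 4) X] [IsManifold (𝓡∂ 4) ∞ X] (D : MultiAttachmentData h (𝓡∂ 4) X) (bX : BoundaryData (𝓡∂ 4) X (𝓡 3)) (Ψ : bX.carrier ≃ₘ⟮𝓡 3, 𝓡 3⟯ (bBase g).carrier) (hpage : ∀ (y : bX.carrier) (a : ↥(coresComplement h)), bX.incl y = D.jA a → ∃ c : ℝ, 0 < c ∧ w g ((bBase g).incl (Ψ y)).1 = (c : ℂ) * w g (a : Base g).1) {X₁ : Type} [TopologicalSpace X₁] [T2Space X₁] [SecondCountableTopology X₁] [CompactSpace X₁] [ChartedSpace (EuclideanHalfSpace 4) X₁] [IsManifold (𝓡∂ 4) ∞ X₁] (D₁ : MultiAttachmentData (fun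 i : Fin P.length => h (Fin.cast List.length_append.symm (Fin.castAdd N.length i))) (𝓡∂ 4) X₁) {W₂ : Type} [TopologicalSpace W₂] [T2Space W₂] [SecondCountableTopology W₂] [CompactSpace W₂] [ChartedSpace (EuclideanHalfSpace 4) W₂] [IsManifold (𝓡∂ 4) ∞ W₂] (b₂ : BoundaryData (𝓡∂ 4) W₂ (𝓡 3)) (φ : (BoundaryManifold.boundaryData 3 X₁).carrier ≃ₘ⟮𝓡 3, 𝓡 3⟯ b₂.carrier) (col : (BoundaryManifold.boundaryData 3 (Base g)).Collar) (κ δ : ℝ) (hκ : 0 < κ) (hκ1 : κ ≤ 1) (hδ : 0 < δ) (hδ2 : δ ≤ 1 / 2) (D₂ : MultiAttachmentData (fun j : Fin N.length => dualMap D bX (bBase g) Ψ col κ δ hκ hκ1 hδ hδ2 (Fin.cast List.length_append.symm (Fin.natAdd P.length j))) (𝓡∂ 4) W₂) (hseam : ∀ (y : (BoundaryManifold.boundaryData 3 X₁).carrier) (a : ↥(coresComplement h)) (ha₁ : (a : Base g) ∈ coresComplement (fun i : Fin P.length => h (Fin.cast List.length_append.symm (Fin.castAdd N.length i)))) (z :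 bX.carrier) (hz : D.jA a = bX.incl z), (BoundaryManifold.boundaryData 3 X₁).incl y = D₁.jA ⟨a, ha₁⟩ → (∀ (j : Fin N.length) (t : ↥(handleTube 3 2)), (h (Fin.cast List.length_append.symm (Fin.natAdd P.length j))).toFun t = (a : Base g) → ‖lamPart ((t : closedBall (0 : EuclideanSpace ℝ (Fin 4)) 1) : EuclideanSpace ℝ (Fin 4))‖ ^ 2 ≤ 1 - 3 * κ ^ 2 / 4) → b₂.incl (φ y) = D₂.jA ⟨(bBase g).incl (Ψ z), incl_mem_coresComplement_dualMap D bX (bBase g) Ψ col κ δ hκ hκ1 hδ hδ2 (fun j : Fin N.length => Fin.cast List.length_append.symm (Fin.natAdd P.length j)) z a hz⟩) (hN0 : ∀ x ∈ N, x.1 ≠ 0) (hNs : ∀ x ∈ N, x.2 = false) (hκK : κ ≤ κ₁) (s' : Bool) (h' : Fin N.length → HandleAttachingMap 3 2 (Base g)) (_ : ∀ j, ∃ c : ℂ, ‖c‖ = 1 ∧ ∀ θ, (h' j).attachingCircle θ ∈ page g c) (_ : ∀ j, shadow g (h' j).attachingCircle (h' j).continuous_attachingCircle ≠ 0) (_ :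 ∀ j, pageTwisting g (h' j).attachingCircle (h' j).attachingFraming = if s' then -1 else 1) (_ : Pairwise fun i j => Disjoint (range (h' i).toFun) (range (h' j).toFun)) (_ : HandleAttachingMap.IsMultiAttachment h' (𝓡∂ 4) W₂), ∃ (q₂ : Fin N.length → HandleAttachingMap 3 2 (Base g)) (D₂p : MultiAttachmentData q₂ (𝓡∂ 4) W₂) (s : Bool), (∀ j, ∃ c : ℂ, ‖c‖ = 1 ∧ ∀ θ, (q₂ j).attachingCircle θ ∈ page g c) ∧ (∀ j, shadow g (q₂ j).attachingCircle (q₂ j).continuous_attachingCircle ≠ 0) ∧ (∀ j, pageTwisting g (q₂ j).attachingCircle (q₂ j).attachingFraming = if s then -1 else 1) ∧ (∃ (y₀ : (BoundaryManifold.boundaryData 3 X₁).carrier) (a₁ : ↥(coresComplement (fun i : Fin P.length => h (Fin.cast List.length_append.symm (Fin.castAdd N.length i))))) (a₂ : ↥(coresComplement q₂)), (BoundaryManifold.boundaryData 3 X₁).incl y₀ = D₁.jA a₁ ∧ b₂.incl (φ y₀) = D₂p.jA a₂ ∧ ∀ (uu : Fin 3 → EuclideanSpace ℝ (Fin 3))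 (v₁ v₂ : Fin 3 → EuclideanSpace ℝ (Fin 4)), (∀ k, mfderiv (𝓡 3) (𝓡∂ 4) (BoundaryManifold.boundaryData 3 X₁).incl y₀ (uu k) = mfderiv (𝓡∂ 4) (𝓡∂ 4) D₁.jA a₁ (v₁ k)) → (∀ k, mfderiv (𝓡 3) (𝓡∂ 4) (b₂.incl ∘ φ) y₀ (uu k) = mfderiv (𝓡∂ 4) (𝓡∂ 4) D₂p.jA a₂ (v₂ k)) → IsPosBdryFrame (fun i : Fin P.length => h (Fin.cast List.length_append.symm (Fin.castAdd N.length i))) a₁ v₁ → 0 < (if s then (1 : ℝ) else -1) * det4 (gradient (rho g) (a₂ : Base g).1) (ambientC q₂ a₂ (v₂ 0)) (ambientC q₂ a₂ (v₂ 1)) (ambientC q₂ a₂ (v₂ 2))) ∧ (∀ ap : ↥(coresComplement q₂), ∃ (a' : ↥(coresComplement (fun j : Fin N.length => dualMap D bX (bBase g) Ψ col κ δ hκ hκ1 hδ hδ2 (Fin.cast List.length_append.symm (Fin.natAdd P.length j))))) (c : ℝ), 0 < c ∧ D₂p.jA ap = D₂.jA a' ∧ w g (ap : Base g).1 = (c :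 ℂ) * w g (a' : Base g).1) ∧ (∀ a' : ↥(coresComplement (fun j : Fin N.length => dualMap D bX (bBase g) Ψ col κ δ hκ hκ1 hδ hδ2 (Fin.cast List.length_append.symm (Fin.natAdd P.length j)))), ∃ ap : ↥(coresComplement q₂), D₂p.jA ap = D₂.jA a') := by
  intro g P N h hlink
  classical
  -- the seam base point: a flat point of the page of direction `1` off the cores
  obtain ⟨q, hq1, hqc⟩ := helper_exists_mem_page_coresComplement g (P ++ N) h hlink 1 (by simp)
  have hqc' : q ∈ coresComplement h := hqc
  have hqN : q ∈ coresComplement (fun j : Fin N.length => h (Fin.cast List.length_append.symm (Fin.natAdd P.length j))) :=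
    (mem_coresComplement _).2 fun j => (mem_coresComplement _).1 hqc' _
  have hqP : q ∈ coresComplement (fun i : Fin P.length => h (Fin.cast List.length_append.symm (Fin.castAdd N.length i))) :=
    (mem_coresComplement _).2 fun i => (mem_coresComplement _).1 hqc' _
  obtain ⟨M, hM0, hM1, hM⟩ := exists_depth_bound
    (fun j : Fin N.length => h (Fin.cast List.length_append.symm (Fin.natAdd P.length j))) hqN
  refine ⟨(1 - M) / 2, by linarith, ?_⟩
  intro X _ _ _ _ _ _ D bX Ψ hpage X₁ _ _ _ _ _ _ D₁ W₂ _ _ _ _ _ _ b₂ φ col κ δ hκ hκ1 hδ hδ2 D₂ hseam hN0 hNs hκK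
    s' h' _ _ _ _ _
  have hcM : M < 1 - 3 * κ ^ 2 / 4 := by nlinarith
  have hcpos : 0 < 1 - 3 * κ ^ 2 / 4 := by nlinarith
  set y₁ : (bBase g).carrier := ⟨q, page_subset_boundary g (by simp) hq1⟩ with hy₁
  haveI : Nonempty bX.carrier := ⟨Ψ.symm y₁⟩
  have hflat : ‖cx y₁.1.1‖ ^ 2 < 4 := (flat_of_mem_page (by simp) hq1).1
  -- (A) G1: the transported dual data
  obtain ⟨m, hm, D₂p, hmar, hjA, -, hpages, hshadows, R1p, R2p⟩ :=
    Hgap_transport g P N h hlink D bX Ψ hpage col κ δ hκ hκ1 hδ hδ2 D₂ hN0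
  -- the sign
  have hs₀ := twistSign_eq_one_or D bX Ψ y₁
  have Hs₀ := twistSign_global_at hlink D bX Ψ hpage hqc' hflat
  have hsZ : (if decide (twistSign D bX Ψ y₁ = 1) then (-1 : ℤ) else 1) = -twistSign D bX Ψ y₁ := by
    rcases hs₀ with h1 | h1 <;> simp [h1]
  have hsR : (if decide (twistSign D bX Ψ y₁ = 1) then (1 : ℝ) else -1) = (twistSign D bX Ψ y₁ : ℝ) := by
    rcases hs₀ with h1 | h1 <;> simp [h1]
  -- the `jA`-bridge of the transport: `D₂p.jA (S_1 p) = D₂.jA p`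
  have bridge : ∀ (p : Base g)
      (hp : p ∈ coresComplement (fun j : Fin N.length => dualMap D bX (bBase g) Ψ col κ δ hκ hκ1 hδ hδ2
        (Fin.cast List.length_append.symm (Fin.natAdd P.length j))))
      (hp' : (strIso g m hm).toFun 1 p ∈ coresComplement (fun j : Fin N.length =>
        (dualMap D bX (bBase g) Ψ col κ δ hκ hκ1 hδ hδ2
          (Fin.cast List.length_append.symm (Fin.natAdd P.length j))).transport ((strIso g m hm).toDiffeomorph 1))),
      D₂p.jA ⟨(strIso g m hm).toFun 1 p, hp'⟩ = D₂.jA ⟨p, hp⟩ := by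
    intro p hp hp'
    rw [hjA]
    congr 1
    apply Subtype.ext
    rw [HgapTransport.coe_coresComplementCongr_str]
    exact str_left_inv m hm p
  -- side-2 membership of seam images
  have hmem₂ : ∀ (y' : (bBase g).carrier) (hy' : (y'.1 : Base g) ∈ coresComplement h),
      seamB D bX Ψ y' ∈ coresComplement (fun j : Fin N.length => dualMap D bX (bBase g) Ψ col κ δ hκ hκ1 hδ hδ2
        (Fin.cast List.length_append.symm (Fin.natAdd P.length j))) := fun y' hy' =>
    incl_mem_coresComplement_dualMap D bX (bBase g) Ψ col κ δ hκ hκ1 hδ hδ2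
      (fun j : Fin N.length => Fin.cast List.length_append.symm (Fin.natAdd P.length j)) (seamLift D bX Ψ y')
      ⟨y'.1, hy'⟩ (incl_seamLift D bX Ψ hy').symm
  have hmem₂' : ∀ (y' : (bBase g).carrier) (hy' : (y'.1 : Base g) ∈ coresComplement h),
      (strIso g m hm).toFun 1 (seamB D bX Ψ y') ∈ coresComplement (fun j : Fin N.length =>
        (dualMap D bX (bBase g) Ψ col κ δ hκ hκ1 hδ hδ2
          (Fin.cast List.length_append.symm (Fin.natAdd P.length j))).transport ((strIso g m hm).toDiffeomorph 1)) :=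
    fun y' hy' => apply_mem_coresComplement_transport _ ((strIso g m hm).toDiffeomorph 1) (hmem₂ y' hy')
  -- side 1: the seam point `y₀` over `q`
  have hb₁ : D₁.jA ⟨q, hqP⟩ ∈ (𝓡∂ 4).boundary X₁ := (isBoundaryPoint_jA_iff D₁ ⟨q, hqP⟩).2 y₁.2
  haveI : Nonempty (BoundaryManifold.boundaryData 3 X₁).carrier := ⟨⟨D₁.jA ⟨q, hqP⟩, hb₁⟩⟩
  have hy₀ : (BoundaryManifold.boundaryData 3 X₁).incl ((BoundaryManifold.boundaryData 3 X₁).inclInv (D₁.jA ⟨q, hqP⟩)) =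
      D₁.jA ⟨q, hqP⟩ := (BoundaryManifold.boundaryData 3 X₁).incl_inclInv hb₁
  -- the local seam formula over strictly shallow points near `q`
  have hloc : ∀ (y' : (bBase g).carrier) (hy' : (y'.1 : Base g) ∈ coresComplement h)
      (hy'P : (y'.1 : Base g) ∈ coresComplement (fun i : Fin P.length => h (Fin.cast List.length_append.symm (Fin.castAdd N.length i))))
      (hsh : ∀ (j : Fin N.length) (t : ↥(handleTube 3 2)),
        (h (Fin.cast List.length_append.symm (Fin.natAdd P.length j))).toFun t = (y'.1 : Base g) →
        ‖lamPart ((t : closedBall (0 : EuclideanSpace ℝ (Fin 4)) 1) : EuclideanSpace ℝ (Fin 4))‖ ^ 2 ≤ 1 - 3 * κ ^ 2 / 4),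
      b₂.incl (φ ((BoundaryManifold.boundaryData 3 X₁).inclInv (D₁.jA ⟨y'.1, hy'P⟩))) =
        D₂p.jA ⟨(strIso g m hm).toFun 1 (seamB D bX Ψ y'), hmem₂' y' hy'⟩ := by
    intro y' hy' hy'P hsh
    have hb' : D₁.jA ⟨y'.1, hy'P⟩ ∈ (𝓡∂ 4).boundary X₁ := (isBoundaryPoint_jA_iff D₁ ⟨y'.1, hy'P⟩).2 y'.2
    have hinc : (BoundaryManifold.boundaryData 3 X₁).incl ((BoundaryManifold.boundaryData 3 X₁).inclInv (D₁.jA ⟨y'.1, hy'P⟩)) =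
        D₁.jA ⟨y'.1, hy'P⟩ := (BoundaryManifold.boundaryData 3 X₁).incl_inclInv hb'
    rw [bridge (seamB D bX Ψ y') (hmem₂ y' hy') (hmem₂' y' hy')]
    exact hseam _ ⟨y'.1, hy'⟩ hy'P (seamLift D bX Ψ y') (incl_seamLift D bX Ψ hy').symm hinc hsh
  -- shallowness at `q` and near `q`
  have hshq : ∀ (j : Fin N.length) (t : ↥(handleTube 3 2)),
      (h (Fin.cast List.length_append.symm (Fin.natAdd P.length j))).toFun t = (y₁.1 : Base g) →
      ‖lamPart ((t : closedBall (0 : EuclideanSpace ℝ (Fin 4)) 1) : EuclideanSpace ℝ (Fin 4))‖ ^ 2 ≤ 1 - 3 * κ ^ 2 / 4 :=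
    fun j t ht => by rw [norm_lamPart_sq]; exact ((hM j t ht).trans hcM.le)
  have hev := eventually_shallow (fun j : Fin N.length => h (Fin.cast List.length_append.symm (Fin.natAdd P.length j)))
    hcpos hcM hM
  refine ⟨fun j : Fin N.length => (dualMap D bX (bBase g) Ψ col κ δ hκ hκ1 hδ hδ2
      (Fin.cast List.length_append.symm (Fin.natAdd P.length j))).transport ((strIso g m hm).toDiffeomorph 1),
    D₂p, decide (twistSign D bX Ψ y₁ = 1),
    fun j => ⟨pageDir (P ++ N).length (P.length + j), norm_pageDir _ _, hpages j⟩, hshadows, fun j => ?_,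
    ⟨(BoundaryManifold.boundaryData 3 X₁).inclInv (D₁.jA ⟨q, hqP⟩), ⟨q, hqP⟩,
      ⟨(strIso g m hm).toFun 1 (seamB D bX Ψ y₁), hmem₂' y₁ hqc'⟩, hy₀, hloc y₁ hqc' hqP hshq, ?_⟩, R1p, R2p⟩
  · -- (B) the twisting clause
    have hB := HBm g (P ++ N) h hlink D bX Ψ hpage (twistSign D bX Ψ y₁) hs₀ Hs₀ col κ δ hκ hκ1 hδ hδ2
      (Fin.cast List.length_append.symm (Fin.natAdd P.length j)) (pageDir (P ++ N).length (P.length + j))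
      (norm_pageDir _ _) m hm (hmar j) (fun θ => hpages j θ)
    rw [hB, hsZ, get_append_natAdd, hNs _ (List.get_mem N j)]
    simp
  · -- (C) the orientation character
    intro uu v₁ v₂ hF1 hF2 hpos
    rw [hsR]
    refine Hgap_character D bX Ψ hpage D₁ (BoundaryManifold.boundaryData 3 X₁) D₂p b₂ φ (strIso g m hm)
      (str_rho_base m hm) y₁ hqc' hflat ⟨q, hqP⟩ rfl _ hy₀ _ rfl ?_ uu v₁ v₂ hF1 hF2 hpos
    -- the local seam formula near `y₁`
    have hopen : ∀ᶠ y' in 𝓝 y₁, (y'.1 : Base g) ∈ coresComplement h := isOpen_seamDom.mem_nhds hqc'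
    have hev' : ∀ᶠ y' : (bBase g).carrier in 𝓝 y₁, ∀ (j : Fin N.length) (t : ↥(handleTube 3 2)),
        (h (Fin.cast List.length_append.symm (Fin.natAdd P.length j))).toFun t = (y'.1 : Base g) →
        lamSq 2 ((t : closedBall (0 : EuclideanSpace ℝ (Fin 4)) 1) : EuclideanSpace ℝ (Fin 4)) < 1 - 3 * κ ^ 2 / 4 :=
      (continuous_subtype_val.continuousAt (x := y₁)).eventually hev
    filter_upwards [hopen, hev'] with y' hy' hsh'
    have hy'P : (y'.1 : Base g) ∈ coresComplement (fun i : Fin P.length => h (Fin.cast List.length_append.symm (Fin.castAdd N.length i))) :=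
      (mem_coresComplement _).2 fun i => (mem_coresComplement _).1 hy' _
    exact ⟨hy'P, hmem₂' y' hy', hloc y' hy' hy'P fun j t ht => by
      rw [norm_lamPart_sq]; exact (hsh' j t ht).le⟩

/-! ## §3 T3 from the margin form alone -/

/-- **T3 from the margin form `HBm` of G2's twisting number ALONE.** [cite: Baykur2006, Thm. 5.1 (proof, pp. 13–14)] -/
theorem T3_of_HBm
    (HBm : ∀ (g : ℕ) (l : List ((Fin g ⊕ Fin g → ℤ) × Bool)) (h : Fin l.length → HandleAttachingMap 3 2 (Base g)),
    IsLefschetzLink g l h →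
    ∀ {X : Type} [TopologicalSpace X] [T2Space X] [SecondCountableTopology X] [CompactSpace X]
      [ChartedSpace (EuclideanHalfSpace 4) X] [IsManifold (𝓡∂ 4) ∞ X]
      (D : MultiAttachmentData h (𝓡∂ 4) X) (bX : BoundaryData (𝓡∂ 4) X (𝓡 3)) [Nonempty bX.carrier]
      (Ψ : bX.carrier ≃ₘ⟮𝓡 3, 𝓡 3⟯ (bBase g).carrier),
      (∀ (y : bX.carrier) (a : ↥(coresComplement h)), bX.incl y = D.jA a →
        ∃ c : ℝ, 0 < c ∧ w g ((bBase g).incl (Ψ y)).1 = (c : ℂ) * w g (a : Base g).1) →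
    ∀ (s₀ : ℤ), (s₀ = 1 ∨ s₀ = -1) →
      (∀ (y : (bBase g).carrier) (_ : (y.1 : Base g) ∈ coresComplement h) (c : ℂ) (_ : ‖c‖ = 1)
        (_ : y.1 ∈ page g c) (R : AmbientIsotopy (𝓡∂ 4) (Base g))
        (_ : ∀ (t : ℝ) (x : Base g), rho g (R.toFun t x).1 = rho g x.1)
        (_ : ∀ (t : ℝ) (x : Base g), ∃ r : ℝ, 0 < r ∧ w g (R.toFun t x).1 = (r : ℂ) * w g x.1)
        (_ : R.toFun 1 (seamB D bX Ψ y) ∈ page g c),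
        0 < (s₀ : ℝ) * pageDet g (bdDeriv g (R.toFun 1 ∘ seamB D bX Ψ) y) y.1.1) →
    ∀ (col : (BoundaryManifold.boundaryData 3 (Base g)).Collar) (κ δ : ℝ) (hκ : 0 < κ) (hκ1 : κ ≤ 1)
      (hδ : 0 < δ) (hδ2 : δ ≤ 1 / 2) (j : Fin l.length) (c : ℂ) (_ : ‖c‖ = 1)
      (m : ℝ) (hm : 0 < m)
      (_ : ∀ θ, 2 * m ≤ ‖w g ((dualMap D bX (bBase g) Ψ col κ δ hκ hκ1 hδ hδ2 j).attachingCircle θ).1‖)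
      (_ : ∀ θ, (strIso g m hm).toFun 1 ((dualMap D bX (bBase g) Ψ col κ δ hκ hκ1 hδ hδ2 j).attachingCircle θ) ∈ page g c),
      pageTwisting g
          ((dualMap D bX (bBase g) Ψ col κ δ hκ hκ1 hδ hδ2 j).transport ((strIso g m hm).toDiffeomorph 1)).attachingCircle
          ((dualMap D bX (bBase g) Ψ col κ δ hκ hκ1 hδ hδ2 j).transport ((strIso g m hm).toDiffeomorph 1)).attachingFraming =
        -s₀ * (if (l.get j).2 then -1 else 1)) :
    ∀ (M : Type) [TopologicalSpace M] [T2Space M] [SecondCountableTopology M] [ChartedSpace (EuclideanSpace ℝ (Fin 4)) M] [IsManifold (𝓡 4) ∞ M] (g : ℕ) (P N : List ((Fin g ⊕ Fin g → ℤ) × Bool)), Literature.Topology.FourManifolds.LefschetzBase.ModelsOnFibred M g (P ++ N) → (∀ x ∈ N, x.2 = false) → (∀ x ∈ P ++ N, x.1 ≠ 0) → ∃ (h : Fin (P ++ N).length → Literature.Topology.FourManifolds.HandleAttachingMap 3 2 (Literature.Topology.FourManifolds.LefschetzBase.Base g)) (X₁ : Type) (_ : TopologicalSpace X₁) (_ :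 T2Space X₁) (_ : SecondCountableTopology X₁) (_ : CompactSpace X₁) (_ : ChartedSpace (EuclideanHalfSpace 4) X₁) (_ : IsManifold (𝓡∂ 4) ∞ X₁) (D₁ : Literature.Topology.FourManifolds.HandleAttachingMap.MultiAttachmentData (fun i : Fin P.length => h (Fin.cast List.length_append.symm (Fin.castAdd N.length i))) (𝓡∂ 4) X₁) (W₂ : Type) (_ : TopologicalSpace W₂) (_ : ChartedSpace (EuclideanHalfSpace 4) W₂) (_ : IsManifold (𝓡∂ 4) ∞ W₂) (_ : CompactSpace W₂) (_ : T2Space W₂) (_ : SecondCountableTopology W₂) (b₁ : Literature.Topology.FourManifolds.BoundaryData (𝓡∂ 4) X₁ (𝓡 3)) (b₂ : Literature.Topology.FourManifolds.BoundaryData (𝓡∂ 4) W₂ (𝓡 3)) (φ : b₁.carrier ≃ₘ⟮𝓡 3, 𝓡 3⟯ b₂.carrier) (h₂ : Fin N.length → Literature.Topology.FourManifolds.HandleAttachingMap 3 2 (Literature.Topology.FourManifolds.LefschetzBase.Base g)) (D₂ : Literature.Topology.FourManifolds.HandleAttachingMap.MultiAttachmentData h₂ (𝓡∂ 4) W₂)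 (F : b₁.carrier → ℂ), Literature.Topology.FourManifolds.LefschetzBase.IsLefschetzLink g (P ++ N) h ∧ Literature.Topology.FourManifolds.IsBoundaryGluing b₁ b₂ φ (𝓡 4) M ∧ (∀ j, ∃ c : ℂ, ‖c‖ = 1 ∧ ∀ θ, (h₂ j).attachingCircle θ ∈ Literature.Topology.FourManifolds.LefschetzBase.page g c) ∧ (∀ j, Literature.Topology.FourManifolds.LefschetzBase.shadow g (h₂ j).attachingCircle (h₂ j).continuous_attachingCircle ≠ 0) ∧ (∀ j, Literature.Topology.FourManifolds.LefschetzBase.pageTwisting g (h₂ j).attachingCircle (h₂ j).attachingFraming = -1) ∧ ContMDiff (𝓡 3) 𝓘(ℝ, ℂ) ∞ F ∧ (∀ y a, b₁.incl y = D₁.jA a → ∃ c : ℝ, 0 < c ∧ F y = c * Literature.Topology.FourManifolds.LefschetzBase.w g a.1.1) ∧ (∀ y a', b₂.incl (φ y) = D₂.jA a' → ∃ c : ℝ, 0 < c ∧ F y = c * Literature.Topology.FourManifolds.LefschetzBase.w g a'.1.1) ∧ (∀ y, F y = 0 → ∃ a, b₁.incl y = D₁.jA a) ∧ (∀ y, F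 y ≠ 0 → ∃ v : EuclideanSpace ℝ (Fin 3), ((starRingEnd ℂ) (F y) * @id ℂ (mfderiv (𝓡 3) 𝓘(ℝ, ℂ) F y v)).im ≠ 0) ∧ (∀ y a, b₁.incl y = D₁.jA a → Literature.Topology.FourManifolds.LefschetzBase.w g a.1.1 = 0 → ∃ a', b₂.incl (φ y) = D₂.jA a') ∧ (∃ (y : b₁.carrier) (a₁ : Literature.Topology.FourManifolds.HandleAttachingMap.coresComplement (fun i : Fin P.length => h (Fin.cast List.length_append.symm (Fin.castAdd N.length i)))) (a₂ : Literature.Topology.FourManifolds.HandleAttachingMap.coresComplement h₂) (uu : Fin 3 → EuclideanSpace ℝ (Fin 3)) (v₁ v₂ : Fin 3 → EuclideanSpace ℝ (Fin 4)), b₁.incl y = D₁.jA a₁ ∧ b₂.incl (φ y) = D₂.jA a₂ ∧ (∀ k, mfderiv (𝓡 3) (𝓡∂ 4) b₁.incl y (uu k) = mfderiv (𝓡∂ 4) (𝓡∂ 4) D₁.jA a₁ (v₁ k)) ∧ (∀ k, mfderiv (𝓡 3) (𝓡∂ 4) (b₂.incl ∘ φ) y (uu k) = mfderiv (𝓡∂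 4) (𝓡∂ 4) D₂.jA a₂ (v₂ k)) ∧ Literature.Geometry.Symplectic.IsPosBdryFrame (fun i : Fin P.length => h (Fin.cast List.length_append.symm (Fin.castAdd N.length i))) a₁ v₁ ∧ Literature.Geometry.Symplectic.IsPosBdryFrame h₂ a₂ v₂) ∧ ConnectedSpace b₁.carrier :=
  T3_of_two_pieces_K helper_seam_twistSign (HgapK_of_HBm HBm)

/-! ## §4 The registered rider -/

/-- **Sub-goal `helper_sign_bool_coupling` of stub `stub_T3_dualPresentation`** (T3 ▸ node `Hgap`, the Bool
of the node; wave 6, lead c5, worker G3): for a sign `s₀ = ±1` the Bool `s := decide (s₀ = 1)` has twisting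
value `if s then -1 else 1 = -s₀` and character value `if s then 1 else -1 = s₀` — the coupling of the two
orientation clauses of T3. [folklore] -/
theorem helper_sign_bool_coupling : ∀ (s₀ : ℤ), (s₀ = 1 ∨ s₀ = -1) → ((if decide (s₀ = 1) then (-1 : ℤ) else 1) = -s₀) ∧ ((if decide (s₀ = 1) then (1 : ℝ) else -1) = (s₀ : ℝ)) := by
  intro s₀ hs₀
  rcases hs₀ with h1 | h1 <;> subst h1 <;> simp

end Summit.SmoothPoincare4.SmoothPoincare4.Theorems.AcyclicBisectionExists.ModpBraidOrbits

end
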